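import Summits.BirchSwinnertonDyer.BirchSwinnertonDyer.Theses.BiquadraticEisensteinDescent
import Literature.NumberTheory.EllipticCurves.HeegnerPoints
import HarnessLib

set_option linter.dupNamespace false
set_option autoImplicit false

/-!
# Sketch (crux-ideate seat 1, g22, round 1) — first lemmas for two crux ideas on
# `HeegnerTwistCouplingInSupply` (stmt-BirchSwinnertonDyer-21381)

Card `eisenstein-shadow-window`: an auxiliary rank-0 elliptic curve `A` with an Eisenstein prime `p`
(`p = 5`: `A = X₀(11)`; `p = 7`: `A = 26b1`) has a weight-3/2 newform whose coefficient `c_A(D)` at a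
fundamental `D < 0` with `(D/q) = -1` satisfies `c_A(D)² = κ · L(A^{(D)},1) · √|D|` (Waldspurger/Gross)
and `c_A(D) ≡ u · h(D) (mod p)` (Mazur 1979 / Gross 1987 Eisenstein congruence).  Hence the
ARCHIMEDEAN WINDOW `0 < |c_A(D)| < p` certifies `p ∤ h(D)` (`|c_A(D)| ≍ |D|^{1/4}` versus
`h(D) ≍ |D|^{1/2}`).  `windowIndivisible` is the (proved) elementary step; `CongruentShadow`,
`JointWindowWitness` and `shadowWindowTransfer` type the transfer of the crux to the joint condition
"`L(W^{(D)},1) ≠ 0` and `0 < |c_A(D)| < p`".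

Card `multiplicity-dial`: a power saving `F(h) ≪ h^{2-δ}` in Soundararajan's class-number multiplicity
function `F(h) = #{D : h(D) = h}` turns, by a union bound over the `≍ √X log X / p` multiples of `p`
below `max_{|D| ≤ X} h(D)`, into "`p ∣ h(D)` is a minority event for `|D| ≤ X ≤ p^{2/(1-δ)-ε}`"
(`MultiplicityBound`, `IndivisibleMajorityWindow`, `windowOfMultiplicity`).

Nothing here is asserted as true; every constant is an existing declaration
(`NumberField.classNumber`, `NumberField.discr`, `jacobiSym`, `WeierstrassCurve.quadraticTwist`,
`WeierstrassCurve.entireLFunction`, `WeierstrassCurve.conductorNorm`,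
`Literature.NumberTheory.EllipticCurves.IsImaginaryQuadratic/SatisfiesHeegnerHypothesis`).
BSD is not proved by any of this.
-/

noncomputable section

open scoped NumberField Classical
open WeierstrassCurve NumberField
open Literature.NumberTheory.EllipticCurves

namespace Summit.BirchSwinnertonDyer.BirchSwinnertonDyer.Cruxes.HeegnerTwistCouplingInSupply.SeatOneG22

/-! ## Card `eisenstein-shadow-window` -/

/-- The elementary window step: an integer `c` congruent mod `p` to a unit multiple of `h`, lying in
the archimedean window `0 < |c| < p`, certifies `p ∤ h`. -/
theorem windowIndivisible (p : ℕ) (h : ℕ) (c : ℤ) (u : ZMod p)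
    (hcong : (c : ZMod p) = u * (h : ZMod p)) (hpos : 0 < |c|) (hlt : |c| < p) :
    ¬ p ∣ h := by
  intro hdiv
  have hh : (h : ZMod p) = 0 := by
    rw [ZMod.natCast_eq_zero_iff]
    exact hdiv
  have hc : (c : ZMod p) = 0 := by rw [hcong, hh, mul_zero]
  rw [ZMod.intCast_zmod_eq_zero_iff_dvd] at hc
  obtain ⟨k, hk⟩ := hc
  have hp0 : (0 : ℤ) < p := lt_of_le_of_lt (abs_nonneg c) hlt
  rcases lt_trichotomy k 0 with hk0 | hk0 | hk0
  · have : |c| ≥ p := by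
      rw [hk, abs_mul, abs_of_pos hp0]
      have : |k| ≥ 1 := by rw [abs_of_neg hk0]; omega
      nlinarith
    omega
  · subst hk0; simp [hk] at hpos
  · have : |c| ≥ p := by
      rw [hk, abs_mul, abs_of_pos hp0]
      have : |k| ≥ 1 := by rw [abs_of_pos hk0]; omega
      nlinarith
    omega

/-- The auxiliary "Eisenstein shadow": a curve `A/ℚ`, primes `p` (Eisenstein for `A`) and `q`
(the prime where the definite quaternion algebra of Gross 1987 ramifies), a unit `u : ZMod p` and an
integer-valued coefficient function `c` on discriminants such that, for every imaginary quadratic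
`K` with `q` inert (`(d_K/q) = -1`) and `4 < |d_K|`:
(i) `c(d_K)² · κ = Re L(A^{(d_K)},1) · √|d_K|` for one fixed `κ > 0` (Waldspurger–Kohnen–Gross), and
(ii) `c(d_K) ≡ u · h_K (mod p)` (Mazur 1979, Gross 1987 §11: Eisenstein congruence in the Brandt module).
For `A = X₀(11) = [0,-1,1,-10,-20]`, `p = 5`, `q = 11` this is in print and was re-checked numerically
(kit j324252: 4176 inert fundamental `|D| ≤ 3·10⁴`, zero failures, `u = 3`). -/
def CongruentShadow (A : WeierstrassCurve ℚ) (p q : ℕ) (u : ZMod p) (c : ℤ → ℤ) : Prop :=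
  (∃ κ : ℝ, 0 < κ ∧ ∀ (K : Type) [Field K] [NumberField K], IsImaginaryQuadratic K →
      jacobiSym (NumberField.discr K) q = -1 → 4 < (NumberField.discr K).natAbs →
        ((c (NumberField.discr K) : ℝ) ^ 2) * κ =
          ((A.quadraticTwist (NumberField.discr K : ℚ)).entireLFunction 1).re *
            Real.sqrt ((NumberField.discr K).natAbs : ℝ)) ∧
  (∀ (K : Type) [Field K] [NumberField K], IsImaginaryQuadratic K →
      jacobiSym (NumberField.discr K) q = -1 → 4 < (NumberField.discr K).natAbs →
        ((c (NumberField.discr K) : ZMod p) = u * (NumberField.classNumber K : ZMod p)))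

/-- The transferred crux `C_A(W, p)`: a Heegner field of `W` with `q` inert whose `W`-twist does not
vanish at `1` AND whose shadow coefficient lies in the archimedean window `0 < |c(d_K)| < p`. -/
def JointWindowWitness (W : WeierstrassCurve ℚ) (p q : ℕ) (c : ℤ → ℤ) : Prop :=
  ∃ (K : Type) (_ : Field K) (_ : NumberField K), IsImaginaryQuadratic K ∧
    4 < (NumberField.discr K).natAbs ∧
    SatisfiesHeegnerHypothesis (W.conductorNorm ℤ) K ∧
    jacobiSym (NumberField.discr K) q = -1 ∧
    (W.quadraticTwist (NumberField.discr K : ℚ)).entireLFunction 1 ≠ 0 ∧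
    0 < |c (NumberField.discr K)| ∧ |c (NumberField.discr K)| < p

/-- FIRST LEMMA of the card (proved): the shadow congruence plus a joint window witness yields the
conclusion of `HeegnerTwistCouplingInSupply` for that `W` and `p`. What remains of the crux is the
existence statement `JointWindowWitness W p q c` (for `p ∈ {5,7}` and the printed shadows). -/
theorem shadowWindowTransfer (W A : WeierstrassCurve ℚ) (p q : ℕ) (u : ZMod p)
    (c : ℤ → ℤ) (hA : CongruentShadow A p q u c) (hW : JointWindowWitness W p q c) :
    ∃ (K : Type) (_ : Field K) (_ : NumberField K), IsImaginaryQuadratic K ∧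
      4 < (NumberField.discr K).natAbs ∧
      SatisfiesHeegnerHypothesis (W.conductorNorm ℤ) K ∧
      (W.quadraticTwist (NumberField.discr K : ℚ)).entireLFunction 1 ≠ 0 ∧
      ¬ p ∣ NumberField.classNumber K := by
  obtain ⟨K, iF, iN, hiq, h4, hH, hq, hL, hpos, hlt⟩ := hW
  refine ⟨K, iF, iN, hiq, h4, hH, hL, ?_⟩
  exact windowIndivisible p (NumberField.classNumber K) (c (NumberField.discr K)) u
    (hA.2 K hiq hq h4) hpos hlt

/-- The printed instance behind the card at `p = 5`: the shadow of `X₀(11)`. (Statement only.) -/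
def X0_11 : WeierstrassCurve ℚ := ⟨0, -1, 1, -10, -20⟩

/-- `p = 5` instance of the congruence package (Mazur 1979 + Gross 1987 + Kohnen–Waldspurger), typed as
a Prop; `u = 3` is the residue observed in kit j324252 (the sign convention of `c` is immaterial). -/
def ShadowCongruenceX0_11 : Prop := ∃ c : ℤ → ℤ, CongruentShadow X0_11 5 11 (3 : ZMod 5) c

/-- Weyl-window form (the provable archimedean half): a subconvex bound
`Re L(A^{(D)},1) ≤ C |D|^{1/2 - 2θ}` with `θ > 1/24` (Weyl: `θ = 1/12`, Conrey–Iwaniec 2000 /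
Petrow–Young 2020) puts every `D` with `|D| < (p²/(κC))^{1/(1-2θ)}` and `c(D) ≠ 0` inside the window.
Typed for a general exponent `η = 1/2 - 2θ`. -/
def WeylWindow (A : WeierstrassCurve ℚ) (η C : ℝ) : Prop :=
  0 < C ∧ ∀ (K : Type) [Field K] [NumberField K], IsImaginaryQuadratic K →
    ((A.quadraticTwist (NumberField.discr K : ℚ)).entireLFunction 1).re ≤
      C * ((NumberField.discr K).natAbs : ℝ) ^ η

/-! ## Card `multiplicity-dial` -/

/-- Soundararajan's multiplicity function, typed on discriminants: the set of discriminants of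
imaginary quadratic fields of class number `h`. -/
def discsOfClassNumber (h : ℕ) : Set ℤ :=
  {D : ℤ | ∃ (K : Type) (_ : Field K) (_ : NumberField K), IsImaginaryQuadratic K ∧
    NumberField.discr K = D ∧ NumberField.classNumber K = h}

/-- `MultiplicityBound δ`: a power saving `F(h) ≤ C · h^{2-δ}` for all `h ≥ 1`
(Soundararajan 2007, conjecture (C1): `F(h) ≍ h` up to logarithms, i.e. every `δ < 1`; known:
only `F(h) ≪ h² (log log h)⁴ / log h`, his Theorem 2). -/
def MultiplicityBound (δ : ℝ) : Prop :=
  ∃ C : ℝ, 0 < C ∧ ∀ h : ℕ, 1 ≤ h →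
    (discsOfClassNumber h).Finite ∧ ((discsOfClassNumber h).ncard : ℝ) ≤ C * (h : ℝ) ^ (2 - δ)

/-- Fundamental discriminants of imaginary quadratic fields in `[-X, -5]`. -/
def negFundDiscsUpTo (X : ℝ) : Set ℤ :=
  {D : ℤ | ∃ (K : Type) (_ : Field K) (_ : NumberField K), IsImaginaryQuadratic K ∧
    NumberField.discr K = D ∧ 4 < D.natAbs ∧ (D.natAbs : ℝ) ≤ X}

/-- Those among them whose class number is divisible by `p`. -/
def negFundDiscsUpToDiv (X : ℝ) (p : ℕ) : Set ℤ :=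
  {D : ℤ | ∃ (K : Type) (_ : Field K) (_ : NumberField K), IsImaginaryQuadratic K ∧
    NumberField.discr K = D ∧ 4 < D.natAbs ∧ (D.natAbs : ℝ) ≤ X ∧ p ∣ NumberField.classNumber K}

/-- `IndivisibleMajorityWindow A`: for all large primes `p`, in every range `|D| ≤ X ≤ p^A`
at most half of the imaginary quadratic fields have `p ∣ h`. (`A = 2 - ε` is classical — there
`h(D) < p` outright; the card's dial is `A = 2/(1-δ) - ε` from `MultiplicityBound δ`.) -/
def IndivisibleMajorityWindow (A : ℝ) : Prop :=
  ∃ p₀ : ℕ, ∀ p : ℕ, p.Prime → p₀ ≤ p → ∀ X : ℝ, 5 ≤ X → X ≤ (p : ℝ) ^ A →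
    2 * ((negFundDiscsUpToDiv X p).ncard : ℝ) ≤ ((negFundDiscsUpTo X).ncard : ℝ)

/-- FIRST LEMMA of the card (union bound over the multiples `p, 2p, …` of `p` below
`max_{|D| ≤ X} h(D) ≤ c₀ √X log X`, against `#negFundDiscsUpTo X ≫ X`): a multiplicity power saving
`δ` opens the indivisibility window to exponent `2/(1-δ) - ε`. Stated, not proved. -/
def windowOfMultiplicity : Prop :=
  ∀ δ ε : ℝ, 0 < δ → δ < 1 → 0 < ε → MultiplicityBound δ → IndivisibleMajorityWindow (2 / (1 - δ) - ε)

end Summit.BirchSwinnertonDyer.BirchSwinnertonDyer.Cruxes.HeegnerTwistCouplingInSupply.SeatOneG22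

end
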